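import Summits.QuantumFields.YangMills.Theorems.SmallFieldWideningAllHeightsSmallTiltPositivity
import Literature.MathematicalPhysics.QuantumFieldTheory.Balaban1983to89.T3InteriorExcision
import HarnessLib

/-!
# Route `SmallFieldWidening` — crux r2 `AllHeightsSmallTilt` (stmt-QuantumFields-22883) IN ROUTE `UnitScaleTilt`'S K1 CURRENCIES AT
# `m = 0`, with the positivity clauses DISCHARGED (support file; width seat `ym-line-sfw-p2-w3` gen 2 of line `ym-line-sfw-p2`)

The director booked r2 «with route UnitScaleTilt's K1 engines» (critic P1: r2 = VARIANT of K1 at `m = 0`).  The tree's K1 machinery is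
typed for EVERY `m : ℕ` — `T3RegularMinimiser.BgStabilityAt/BgFluctuationAt F γ b₀ p₀ m A₀ A₁` (background stability ∧ fluctuation
comparison for an arbitrary pair of background functionals), `T3PrintedRegularMinimiser.MinimiserStabilityRegPrAt/FluctuationComparisonRegPrAt
F γ b₀ p₀ m ε₀` (the same at print's regular backgrounds = the bodies of UST's items K1aR-pr stmt-QuantumFields-19200 and K1bR-pr), and
`unitTiltAt_of_bg` — and UST's items merely quantify `m ≥ m₀`.  This file records what that booking means BY NAME:

* §1 `allHeightsSmallTilt_of_regPr_zero` — **r2 ⇐ (K1aR-pr body at `m = 0`) ∧ (K1bR-pr body at `m = 0`)** under the route prefix: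
  `MinimiserStabilityRegPrAt F γ b₀ p₀ 0 ε₀ ∧ FluctuationComparisonRegPrAt F γ b₀ p₀ 0 ε₀ ⇒ UnitTiltAt F γ b₀ p₀ 0`
  (`heightSandwich_unitTilt_of_regPr`); `allHeightsSmallTilt_of_bg_zero` — the functional-agnostic form (ANY backgrounds `A₀, A₁`).
* §2 `allHeightsSmallTilt_of_stability_and_logComparison` — **THE REDUCED TWO-ESTIMATE FORM OF r2, positivity discharged**: since both
  fully-constrained unit densities are a.e. POSITIVE on the window for small coupling (p589150 `heightDensity_histGood_pos_ae` at `n = 0`),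
  r2 follows from two purely quantitative estimates on the unit-lattice window `{PlaqSmall θBal(0)}`, for any backgrounds `A₀ K, A₁ K`:
  (E-min₀) `|A₁ K V − A₀ K V − κ_K| ≤ r_K` and (E-ker₀) `|(log ρ^{(K+1)}_{K+1} V + A₁ K V) − (log ρ^{(K)}_K V + A₀ K V) − κ'_K| ≤ r'_K`
  a.e. GIVEN positivity of both densities at `V`, with `Σ r_K, Σ r'_K < ∞` — everything stated at the literal height `0` (no `K / 0`).

WHAT THIS IS NOT: neither estimate is proved (they are the E3 content of r2 = [King1986] Thm 3.4 (3.9) at the terminal lattice for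
`SU(2)`, [Balaban1985UV3] (41)/(47) one-run envelopes printed); no summit statement is touched (rung R3 record; the Yang–Mills mass gap is
not proved by this line).
-/

noncomputable section

open MeasureTheory Filter Topology
open scoped ENNReal
open Literature.MathematicalPhysics.QuantumFieldTheory
open Literature.MathematicalPhysics.QuantumFieldTheory.Balaban1983to89
open Literature.MathematicalPhysics.QuantumFieldTheory.Balaban1983to89.Missing
open Literature.MathematicalPhysics.QuantumFieldTheory.Balaban1983to89.T3ContinuumYM3Torus
open Literature.MathematicalPhysics.QuantumFieldTheory.Balaban1983to89.T3LevelShift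
open Literature.MathematicalPhysics.QuantumFieldTheory.Balaban1983to89.T3UnitScaleTilt
open Literature.MathematicalPhysics.QuantumFieldTheory.Balaban1983to89.T3UnitLawDensityEML
open Literature.MathematicalPhysics.QuantumFieldTheory.Balaban1983to89.T3TiltDescent
open Literature.MathematicalPhysics.QuantumFieldTheory.Balaban1983to89.T3CruxEstimates
open Literature.MathematicalPhysics.QuantumFieldTheory.Balaban1983to89.T3RegularMinimiser
open Literature.MathematicalPhysics.QuantumFieldTheory.Balaban1983to89.T3PrintedRegularMinimiser

namespace Summit.QuantumFields.YangMills.Theorems.AllHeightsSmallTilt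

/-! ## §1 r2 ⇐ route `UnitScaleTilt`'s K1 twins at `m = 0` -/

/-- **r2 ⇐ (K1aR-pr ∧ K1bR-pr) AT `m = 0`**: if for every `L` and profile `(b₀ > 0, p₀ > 2)` there are a regularity radius `ε₀` and
`γ₁ > 0` such that every family with `F.L = L` at `0 < γ ≤ γ₁` satisfies `MinimiserStabilityRegPrAt F γ b₀ p₀ 0 ε₀` (two-cut-off
stability of print's regular-minimiser actions, all heights constrained) and `FluctuationComparisonRegPrAt F γ b₀ p₀ 0 ε₀` (the two runs'
fluctuation parts agree, positivity included), then `AllHeightsSmallTilt` (`heightSandwich_unitTilt_of_regPr` at `m = 0`).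
[cite: King1986, Thm 3.4 (3.9)-(3.13) p.656] -/
theorem allHeightsSmallTilt_of_regPr_zero
    (h : ∀ (L : ℕ) (b₀ p₀ : ℝ), 0 < b₀ → 2 < p₀ → ∃ ε₀ γ₁ : ℝ, 0 < γ₁ ∧
      ∀ (F : T3Family) (γ : ℝ), F.L = L → 0 < γ → γ ≤ γ₁ →
        MinimiserStabilityRegPrAt F γ b₀ p₀ 0 ε₀ ∧ FluctuationComparisonRegPrAt F γ b₀ p₀ 0 ε₀) :
    Summit.QuantumFields.YangMills.Theses.SmallFieldWidening.AllHeightsSmallTilt := by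
  intro L b₀ p₀ hb₀ hp₀
  obtain ⟨ε₀, γ₁, hγ₁, H⟩ := h L b₀ p₀ hb₀ hp₀
  refine ⟨γ₁, hγ₁, fun F γ hFL hγ hle => ?_⟩
  obtain ⟨h₁, h₂⟩ := H F γ hFL hγ hle
  exact (heightSandwich_unitTilt_of_regPr hγ.le h₁ h₂).2

/-- **r2 ⇐ BACKGROUND STABILITY ∧ FLUCTUATION COMPARISON AT `m = 0` FOR ANY BACKGROUNDS** (the functional-agnostic split
`T3RegularMinimiser.unitTiltAt_of_bg` at `m = 0`; the backgrounds live on the comparison lattice `F.P (K / 0)`, i.e. the unit lattice).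
[cite: King1986, Thm 3.4 (3.9)-(3.13) p.656] -/
theorem allHeightsSmallTilt_of_bg_zero
    (h : ∀ (L : ℕ) (b₀ p₀ : ℝ), 0 < b₀ → 2 < p₀ → ∃ γ₁ : ℝ, 0 < γ₁ ∧
      ∀ (F : T3Family) (γ : ℝ), F.L = L → 0 < γ → γ ≤ γ₁ →
        ∃ A₀ A₁ : (K : ℕ) → GaugeField (F.P (K / 0)) 0 (Matrix.specialUnitaryGroup (Fin 2) ℂ) → ℝ,
          BgStabilityAt F γ b₀ p₀ 0 A₀ A₁ ∧ BgFluctuationAt F γ b₀ p₀ 0 A₀ A₁) :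
    Summit.QuantumFields.YangMills.Theses.SmallFieldWidening.AllHeightsSmallTilt := by
  intro L b₀ p₀ hb₀ hp₀
  obtain ⟨γ₁, hγ₁, H⟩ := h L b₀ p₀ hb₀ hp₀
  refine ⟨γ₁, hγ₁, fun F γ hFL hγ hle => ?_⟩
  obtain ⟨A₀, A₁, h₁, h₂⟩ := H F γ hFL hγ hle
  exact unitTiltAt_of_bg hγ.le h₁ h₂

/-! ## §2 The reduced two-estimate form of r2 (positivity discharged, literal height `0`) -/

/-- **r2 ⇐ TWO QUANTITATIVE ESTIMATES ON THE UNIT-LATTICE WINDOW, POSITIVITY DISCHARGED.**  For every `L` and profile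
`(b₀ > 0, p₀ > 2)` suppose there is `γ₁ > 0` such that every family with `F.L = L` at `0 < γ ≤ γ₁` admits backgrounds `A₀ K, A₁ K` (real
functions of the unit-lattice datum; e.g. `β_K·minAction`) and summable `r, r' ≥ 0` with constants `κ, κ'` such that for every run `K`:
(E-min₀) `|A₁ K V − A₀ K V − κ_K| ≤ r_K` for every `V` in the window `PlaqSmall θBal(0)`; (E-ker₀) for a.e. `V` in the window AT WHICH BOTH
fully-constrained unit densities `ρ^{(K)}_K = heightDensity F γ _ (histGood K 0)`, `ρ^{(K+1)}_{K+1}` ARE POSITIVE,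
`|(log ρ^{(K+1)}_{K+1} V + A₁ K V) − (log ρ^{(K)}_K V + A₀ K V) − κ'_K| ≤ r'_K`.  Then `AllHeightsSmallTilt`.  The positivity premiss
of (E-ker₀) is free: both densities ARE a.e. positive on the window for `γ ≤ γ₁(L, b₀, p₀)` (p589150 `heightDensity_histGood_pos_ae`,
`n = 0`); off the window both vanish a.e. (`heightDensity_histGood_ae_eq_zero`); so the two estimates give the a.e. sandwich with
radius `r_K + r'_K` and constant `e^{κ'_K − κ_K}`, hence the descended tilt (`isTilt_descendTo_of_sandwich_ae`, `n = 0`) and the unit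
tilt (`isTilt_unitA_of_isTilt_descendTo`). [cite: King1986, Thm 3.4 (3.9)-(3.13) p.656] -/
theorem allHeightsSmallTilt_of_stability_and_logComparison
    (h : ∀ (L : ℕ) (b₀ p₀ : ℝ), 0 < b₀ → 2 < p₀ → ∃ γ₁ : ℝ, 0 < γ₁ ∧
      ∀ (F : T3Family) (γ : ℝ), F.L = L → 0 < γ → γ ≤ γ₁ →
        ∃ (A₀ A₁ : ℕ → GaugeField (F.P 0) 0 (Matrix.specialUnitaryGroup (Fin 2) ℂ) → ℝ) (r κ r' κ' : ℕ → ℝ),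
          Summable r ∧ Summable r' ∧ (∀ K, 0 ≤ r K) ∧ (∀ K, 0 ≤ r' K) ∧
          (∀ (K : ℕ) (V : GaugeField (F.P 0) 0 (Matrix.specialUnitaryGroup (Fin 2) ℂ)),
            PlaqSmall (θBal F.L γ b₀ p₀ 0) V → |A₁ K V - A₀ K V - κ K| ≤ r K) ∧
          (∀ K : ℕ, ∀ᵐ V ∂fieldMeasure (F.P 0) 0 (Matrix.specialUnitaryGroup (Fin 2) ℂ),
            PlaqSmall (θBal F.L γ b₀ p₀ 0) V →
              0 < heightDensity F γ (Nat.zero_le K) (histGood F ℰp (θBal F.L γ b₀ p₀) K 0) V →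
              0 < heightDensity F γ (Nat.zero_le (K + 1)) (histGood F ℰp (θBal F.L γ b₀ p₀) (K + 1) 0) V →
                |(Real.log (heightDensity F γ (Nat.zero_le (K + 1)) (histGood F ℰp (θBal F.L γ b₀ p₀) (K + 1) 0) V) + A₁ K V) -
                  (Real.log (heightDensity F γ (Nat.zero_le K) (histGood F ℰp (θBal F.L γ b₀ p₀) K 0) V) + A₀ K V) -
                    κ' K| ≤ r' K)) :
    Summit.QuantumFields.YangMills.Theses.SmallFieldWidening.AllHeightsSmallTilt := by
  intro L b₀ p₀ hb₀ hp₀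
  obtain ⟨γ₁, hγ₁, H⟩ := h L b₀ p₀ hb₀ hp₀
  obtain ⟨γ₂, hγ₂, -, P⟩ := heightDensity_histGood_pos_ae L b₀ p₀ hb₀ hp₀
  refine ⟨min γ₁ γ₂, lt_min hγ₁ hγ₂, fun F γ hFL hγ hle => ?_⟩
  obtain ⟨A₀, A₁, r, κ, r', κ', hr, hr', hr0, hr0', hst, hfl⟩ := H F γ hFL hγ (hle.trans (min_le_left _ _))
  have hpos : ∀ K : ℕ, ∀ᵐ V ∂fieldMeasure (F.P 0) 0 (Matrix.specialUnitaryGroup (Fin 2) ℂ),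
      PlaqSmall (θBal F.L γ b₀ p₀ 0) V → 0 < heightDensity F γ (Nat.zero_le K) (histGood F ℰp (θBal F.L γ b₀ p₀) K 0) V :=
    fun K => P F γ hFL hγ (hle.trans (min_le_right _ _)) 0 K (Nat.zero_le K)
  refine ⟨fun K => r K + r' K, hr.add hr', fun K => ?_⟩
  -- the a.e. two-run sandwich of the fully-constrained unit densities, radius `r_K + r'_K`, constant `e^{κ'_K − κ_K}`
  have hz₀ := heightDensity_histGood_ae_eq_zero F hγ.le (Nat.zero_le K) (θBal F.L γ b₀ p₀)
  have hz₁ := heightDensity_histGood_ae_eq_zero F hγ.le (Nat.zero_le (K + 1)) (θBal F.L γ b₀ p₀)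
  have hsand : ∀ᵐ V ∂fieldMeasure (F.P 0) 0 (Matrix.specialUnitaryGroup (Fin 2) ℂ),
      Real.exp (-(r K + r' K)) * Real.exp (κ' K - κ K) *
            heightDensity F γ (Nat.zero_le K) (histGood F ℰp (θBal F.L γ b₀ p₀) K 0) V ≤
          heightDensity F γ ((Nat.zero_le K).trans (Nat.le_succ K)) (histGood F ℰp (θBal F.L γ b₀ p₀) (K + 1) 0) V ∧
        heightDensity F γ ((Nat.zero_le K).trans (Nat.le_succ K)) (histGood F ℰp (θBal F.L γ b₀ p₀) (K + 1) 0) V ≤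
          Real.exp (r K + r' K) * Real.exp (κ' K - κ K) *
            heightDensity F γ (Nat.zero_le K) (histGood F ℰp (θBal F.L γ b₀ p₀) K 0) V := by
    filter_upwards [hfl K, hpos K, hpos (K + 1), hz₀, hz₁] with V hV hp₀ hp₁ hVz₀ hVz₁
    by_cases hs : PlaqSmall (θBal F.L γ b₀ p₀ 0) V
    · have hP₀ := hp₀ hs
      have hP₁ := hp₁ hs
      have hlog : |Real.log (heightDensity F γ (Nat.zero_le (K + 1)) (histGood F ℰp (θBal F.L γ b₀ p₀) (K + 1) 0) V) -
          Real.log (heightDensity F γ (Nat.zero_le K) (histGood F ℰp (θBal F.L γ b₀ p₀) K 0) V) - (κ' K - κ K)| ≤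
          r K + r' K := by
        obtain ⟨a1, a2⟩ := abs_le.mp (hV hs hP₀ hP₁)
        obtain ⟨b1, b2⟩ := abs_le.mp (hst K V hs)
        exact abs_le.mpr ⟨by linarith, by linarith⟩
      exact T3InteriorExcision.sandwich_of_log hP₀ hP₁ hlog
    · rw [hVz₀ hs, hVz₁ hs, mul_zero, mul_zero]
      exact ⟨le_rfl, le_rfl⟩
  have hdesc := isTilt_descendTo_of_sandwich_ae F hγ.le (Nat.zero_le K)
    (measurableSet_histGood F ℰp measurableE_ℰp (θBal F.L γ b₀ p₀) K 0)
    (measurableSet_histGood F ℰp measurableE_ℰp (θBal F.L γ b₀ p₀) (K + 1) 0)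
    (add_nonneg (hr0 K) (hr0' K)) (Real.exp_pos (κ' K - κ K)) hsand
  have ht := isTilt_unitA_of_isTilt_descendTo F ℰp measurableE_ℰp hγ.le (Nat.zero_le K) _ _ hdesc
  simpa only [Nat.div_zero] using ht

end Summit.QuantumFields.YangMills.Theorems.AllHeightsSmallTilt

end
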